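import Mathlib
import HarnessLib
import Summits.HubbardSuperconductivity.HubbardSuperconductivity.Theses.AposterioriCapRg
import Literature.MathematicalPhysics.QuantumLattice.DWaveSource
import Literature.MathematicalPhysics.QuantumLattice.DWaveOrderParameterProofs

/-!
# Sketch — crux-ideate stmt-HubbardSuperconductivity-1313 (AposterioriCapRg.FixedPointDWaveOrder), ideator 2, round 1

First lemmas of three crux idea cards (statements must elaborate; the compositions into the crux
are PROVED so the audit can confirm each transfer concludes `FixedPointDWaveOrder` BY NAME).

* card `plateau-kt-bridge-fixed-point`: `PlateauToOrder` (Koma–Tasaki 1993 Thm 7.1/7.3 =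
  Kaplan–Horsch–von der Linden, grand-canonical tracial form, constant `√(a/2)`; provable now),
  its constant-1 canonical refinement `AndersonTower` (exact/near-ground sector states with a
  pair-transfer amplitude floor; provable now), the re-aimed targets `FixedPointPlateau`,
  `FixedPointAnderson`, and the compositions `fixedPoint_of_plateau`, `fixedPoint_of_anderson`.
* card `griffiths-density-brackets`: `DensityByGriffiths` (Griffiths' lemma for the concave
  grand-canonical energy densities + two coarse chords; provable now), the re-aimed target
  `FixedPointByBrackets` and the composition `fixedPoint_of_brackets`.
* card `thermal-ray-kt-order`: `ThermalStair` (entropy sandwich + h-chord: the sourced GIBBS state at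
  `β = κ/h`, source `h/2`, bounds the sourced ground-state density at `h` from below up to `log 4/κ`,
  uniformly in `L`; provable now), its liminf form `ThermalStairLiminf`, the re-aimed target
  `ThermalRayOrder` and the composition `fixedPoint_of_thermalRay`.
-/

namespace Summit.HubbardSuperconductivity.HubbardSuperconductivity.Cruxes.FixedPointDWaveOrder.Ideator2

open scoped BigOperators Matrix
open Filter
open Literature.Probability.LatticeModels Literature.MathematicalPhysics.QuantumLattice
open Summit.HubbardSuperconductivity.HubbardSuperconductivity.Theses.AposterioriCapRg

/-- The crux's density conjunct, verbatim. -/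
def DensityClause (U δ μ : ℝ) : Prop :=
  Filter.Tendsto (fun L : ℕ => ((hubbardTorusWith 2 (L + 1) 1 U μ).groundStateFunctional
    totalNumber).re / ((L + 1 : ℕ) : ℝ) ^ 2) Filter.atTop (nhds (1 - δ))

/-! ## Card A — zero-field plateau + Koma–Tasaki bridge at the fixed point -/

/-- Koma–Tasaki 1993 Thm 7.1/7.3 (Kaplan–Horsch–von der Linden) for the grand-canonical Hubbard
torus, tracial form: zero-field plateau `d`-wave pair LRO `a > 0` of the TRACIAL ground-state
functional of `hubbardTorusWith 2 L 1 U μ` along `L → ∞` forces `dWaveOrderParameter U μ ≥ √(a/2)`.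
Proof plan (provable now, M): `Δ_d†Δ_d` commutes with `N`, so some `N`-eigen ground vector `Φ` has
`⟨PᴴP⟩ ≥ aL⁴` (`P = pairField dWaveFormFactor L`); with `O = P + Pᴴ`, `⟨Φ,OΦ⟩ = ⟨Φ,O³Φ⟩ = 0`,
`‖OΦ‖² ≥ 2aL⁴ − ‖[P,Pᴴ]‖ ≥ 2aL⁴ − C₁L²`; trial state `Ξ = (Φ + OΦ/‖OΦ‖)/√2`:
`⟨Ξ,OΞ⟩ = ‖OΦ‖`, `⟨Ξ,(H−μN)Ξ⟩ = E₀ + ⟨[O,[H−μN,O]]⟩/(4‖OΦ‖²) ≤ E₀ + C₂L²/(4(2aL⁴ − C₁L²))`;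
variational principle for `dWaveSourceTorus L U μ h = (H−μN) − hO`; divide by `2hL²` and use
`le_dWaveOrderParameter_of_le_liminf_energyGain`. Same statement as `KTBridge` of the
NodalReduction ideator-2 sketch (shared bridge). -/
def PlateauToOrder : Prop :=
  ∀ U μ a : ℝ, 0 < a →
    (∀ᶠ L : ℕ in atTop, a * (((L + 1 : ℕ) : ℝ)) ^ 4 ≤
      ((hubbardTorusWith 2 (L + 1) 1 U μ).groundStateFunctional
        ((pairField dWaveFormFactor (L + 1))ᴴ * pairField dWaveFormFactor (L + 1))).re) →
    Real.sqrt (a / 2) ≤ dWaveOrderParameter U μ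

/-- The constant-1 canonical refinement ("Anderson tower"): if for every `K` and all large `L`
there are unit vectors `Φ₀,…,Φ_{K+1}` in consecutive even charge sectors `(N₀+2j, S^z=0)` whose
grand-canonical energies stay within a constant `C = C(K)` of the grand-canonical ground energy and
whose successive pair-transfer amplitudes satisfy `Re⟨Φ_{j+1}, Pᴴ Φ_j⟩ ≥ a L²`, then
`dWaveOrderParameter U μ ≥ a`. Proof plan (provable now, M): trial state `Ψ = (K+2)^{-1/2} Σ_j Φ_j`
(orthogonal sectors); `⟨Ψ,(H−μN)Ψ⟩ ≤ E₀ + C` (sector-diagonal); `⟨Ψ,(P+Pᴴ)Ψ⟩ ≥ 2aL²(K+1)/(K+2)`;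
variational principle: `E(0) − E(h) ≥ 2haL²(K+1)/(K+2) − C`; divide by `2hL²`, `L → ∞`, `K → ∞`.
With `Φ_j` the exact sector ground states this is the Penrose–Onsager–Anderson form of ODLRO. -/
def AndersonTower : Prop :=
  ∀ U μ a : ℝ, 0 < a →
    (∀ K : ℕ, ∃ C : ℝ, ∀ᶠ L : ℕ in atTop, ∃ N₀ : ℕ,
      ∃ Φ : ℕ → Fock (Orb (FermionTorus 2 (L + 1))),
        (∀ j ≤ K + 1, star (Φ j) ⬝ᵥ Φ j = 1 ∧ Φ j ∈ szSector (N₀ + 2 * j) 0 ∧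
          (star (Φ j) ⬝ᵥ (hubbardTorusWith 2 (L + 1) 1 U μ *ᵥ Φ j)).re ≤
            (hubbardTorusWith 2 (L + 1) 1 U μ).groundEnergy + C) ∧
        (∀ j ≤ K, a * (((L + 1 : ℕ) : ℝ)) ^ 2 ≤
          (star (Φ (j + 1)) ⬝ᵥ ((pairField dWaveFormFactor (L + 1))ᴴ *ᵥ Φ j)).re)) →
    a ≤ dWaveOrderParameter U μ

/-- Re-aimed target (C⁺ of card A): zero-field TRACIAL grand-canonical plateau pair order at a
density-matched point of the box. No source, no `h → 0⁺` after `L → ∞`. -/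
def FixedPointPlateau : Prop :=
  ∃ U ∈ Set.Icc (2:ℝ) 3, ∃ δ ∈ Set.Icc (1/5:ℝ) (7/20), ∃ μ : ℝ, DensityClause U δ μ ∧
    ∃ a : ℝ, 0 < a ∧ ∀ᶠ L : ℕ in atTop, a * (((L + 1 : ℕ) : ℝ)) ^ 4 ≤
      ((hubbardTorusWith 2 (L + 1) 1 U μ).groundStateFunctional
        ((pairField dWaveFormFactor (L + 1))ᴴ * pairField dWaveFormFactor (L + 1))).re

/-- Re-aimed target, canonical form (C⁺′ of card A): an Anderson-tower amplitude floor at a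
density-matched point of the box. -/
def FixedPointAnderson : Prop :=
  ∃ U ∈ Set.Icc (2:ℝ) 3, ∃ δ ∈ Set.Icc (1/5:ℝ) (7/20), ∃ μ : ℝ, DensityClause U δ μ ∧
    ∃ a : ℝ, 0 < a ∧ ∀ K : ℕ, ∃ C : ℝ, ∀ᶠ L : ℕ in atTop, ∃ N₀ : ℕ,
      ∃ Φ : ℕ → Fock (Orb (FermionTorus 2 (L + 1))),
        (∀ j ≤ K + 1, star (Φ j) ⬝ᵥ Φ j = 1 ∧ Φ j ∈ szSector (N₀ + 2 * j) 0 ∧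
          (star (Φ j) ⬝ᵥ (hubbardTorusWith 2 (L + 1) 1 U μ *ᵥ Φ j)).re ≤
            (hubbardTorusWith 2 (L + 1) 1 U μ).groundEnergy + C) ∧
        (∀ j ≤ K, a * (((L + 1 : ℕ) : ℝ)) ^ 2 ≤
          (star (Φ (j + 1)) ⬝ᵥ ((pairField dWaveFormFactor (L + 1))ᴴ *ᵥ Φ j)).re)

/-- Card A composes into the crux BY NAME. -/
theorem fixedPoint_of_plateau (hB : PlateauToOrder) (hP : FixedPointPlateau) :
    FixedPointDWaveOrder := by
  obtain ⟨U, hU, δ, hδ, μ, hdens, a, ha, hplat⟩ := hP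
  refine ⟨U, hU, δ, hδ, μ, hdens, ?_⟩
  have hle : Real.sqrt (a / 2) ≤ dWaveOrderParameter U μ := hB U μ a ha hplat
  have hpos : 0 < Real.sqrt (a / 2) := Real.sqrt_pos.2 (by positivity)
  exact (hasDWaveOrder_iff U μ).2 (lt_of_lt_of_le hpos hle)

/-- Card A, canonical form, composes into the crux BY NAME. -/
theorem fixedPoint_of_anderson (hT : AndersonTower) (hA : FixedPointAnderson) :
    FixedPointDWaveOrder := by
  obtain ⟨U, hU, δ, hδ, μ, hdens, a, ha, htower⟩ := hA
  refine ⟨U, hU, δ, hδ, μ, hdens, ?_⟩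
  have hle : a ≤ dWaveOrderParameter U μ := hT U μ a ha htower
  exact (hasDWaveOrder_iff U μ).2 (lt_of_lt_of_le ha hle)

/-! ## Card B — the density conjunct by Griffiths' lemma and two coarse chords -/

/-- Grand-canonical ground-state energy density on the torus of side `L`. -/
noncomputable def gcEnergyDensity (L : ℕ) [NeZero L] (U μ : ℝ) : ℝ :=
  (hubbardTorusWith 2 L 1 U μ).groundEnergy / (L : ℝ) ^ 2

/-- Griffiths' lemma packaged for this crux: if the grand-canonical ground-state energy densities
converge pointwise in `μ` to a limit `e` (thermodynamic limit along ALL sides `L+1`, odd included)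
and two coarse finite chords of `e` bracket the densities of the interval `(μ₁, μ₂)` into
`[13/20, 4/5]`, then SOME `μ ∈ (μ₁, μ₂)` has a convergent grand-canonical density `1 − δ` with
`δ ∈ [1/5, 7/20]`. Proof plan (provable now, M): each `e_L = gcEnergyDensity (L+1) U ·` is concave
(minimum of affine functions of `μ`) and `−density_L(μ)` is a supergradient (variational principle
with the tracial ground state of `H − μN` at `μ'`), so `e` is concave, differentiable off a countable
set, and at every differentiability point `μ` the densities converge to `ρ(μ) = −e′(μ)` (chord
sandwich); monotonicity of `ρ` and the two chords give `ρ(μ) ∈ [ρ(μ₁⁺), ρ(μ₂⁻)] ⊆ [13/20, 4/5]`. -/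
def DensityByGriffiths : Prop :=
  ∀ (U : ℝ) (e : ℝ → ℝ) (μ₁ μ₂ x : ℝ), μ₁ < μ₂ → 0 < x →
    (∀ μ' : ℝ, Filter.Tendsto (fun L : ℕ => gcEnergyDensity (L + 1) U μ') Filter.atTop
      (nhds (e μ'))) →
    13 / 20 * x ≤ e (μ₁ - x) - e μ₁ → e μ₂ - e (μ₂ + x) ≤ 4 / 5 * x →
    ∃ μ ∈ Set.Ioo μ₁ μ₂, ∃ δ ∈ Set.Icc (1/5:ℝ) (7/20), DensityClause U δ μ

/-- Re-aimed target (C⁺ of card B): Koma–Tasaki order on a `μ`-INTERVAL at fixed `U` in `[2,3]`,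
plus existence of the thermodynamic-limit energy density and two COARSE certified chords
(accuracy ~10⁻² in density, i.e. energy sandwiches of width ~2·10⁻³ t at four values of `μ`). The
engine never computes a density and no Luttinger-type statement is used. -/
def FixedPointByBrackets : Prop :=
  ∃ U ∈ Set.Icc (2:ℝ) 3, ∃ μ₁ μ₂ x : ℝ, μ₁ < μ₂ ∧ 0 < x ∧
    (∀ μ ∈ Set.Ioo μ₁ μ₂, HasDWaveOrder U μ) ∧
    ∃ e : ℝ → ℝ,
      (∀ μ' : ℝ, Filter.Tendsto (fun L : ℕ => gcEnergyDensity (L + 1) U μ') Filter.atTop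
        (nhds (e μ'))) ∧
      13 / 20 * x ≤ e (μ₁ - x) - e μ₁ ∧ e μ₂ - e (μ₂ + x) ≤ 4 / 5 * x

/-- Card B composes into the crux BY NAME. -/
theorem fixedPoint_of_brackets (hG : DensityByGriffiths) (hB : FixedPointByBrackets) :
    FixedPointDWaveOrder := by
  obtain ⟨U, hU, μ₁, μ₂, x, h12, hx, hord, e, hlim, hc₁, hc₂⟩ := hB
  obtain ⟨μ, hμ, δ, hδ, hdens⟩ := hG U e μ₁ μ₂ x h12 hx hlim hc₁ hc₂
  exact ⟨U, hU, δ, hδ, μ, hdens, hord μ hμ⟩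

/-! ## Card C — the thermal ray `T = h/κ` inside the Koma–Tasaki order parameter -/

/-- The sourced Gibbs-state pair density `m_L(β, s) = Re ω_{β}^{L,s}(P)/L²` of
`dWaveSourceTorus L U μ s` at inverse temperature `β`. -/
noncomputable def thermalPairDensity (L : ℕ) [NeZero L] (U μ β s : ℝ) : ℝ :=
  ((dWaveSourceTorus L U μ s).gibbsState β (pairField dWaveFormFactor L)).re / (L : ℝ) ^ 2

/-- THE THERMAL STAIR (finite volume, uniform in `L`): for every `κ, h > 0`,
`m_L(β = κ/h, h/2) − log 4/κ ≤ dWaveSourceDensity L U μ h`. Proof plan (provable now, M):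
`2L²·m^{GS}_L(h) ≥ (E(h/2) − E(h))/(h/2)` (every ground state of the source-`h` Hamiltonian, by
concavity of `E(·)`: tree `dWaveSourceDensity_mul_le_groundEnergy_drop`-type chord), `E(h/2) ≥ F_β(h/2)`
and `E(h) ≤ F_β(h) + β⁻¹ log dim`, `dim = 4^{L²}` (Peierls–Bogoliubov / entropy sandwich), and
`F_β(h/2) − F_β(h) = ∫ ⟨P+Pᴴ⟩_{β,s} ds ≥ (h/2)·2L²·2 m_L(β,h/2)` (`F_β` concave in the source,
Duhamel derivative); with `β = κ/h` the defect is exactly `log 4/κ`. -/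
def ThermalStair : Prop :=
  ∀ (L : ℕ) [NeZero L] (U μ κ h : ℝ), 0 < κ → 0 < h →
    thermalPairDensity L U μ (κ / h) (h / 2) - Real.log 4 / κ ≤ dWaveSourceDensity L U μ h

/-- Its liminf form (from `ThermalStair` and the a-priori bounds `|·| ≤ B_d`). -/
def ThermalStairLiminf : Prop :=
  ∀ (U μ κ h ε : ℝ), 0 < κ → 0 < h →
    ε ≤ liminf (fun L : ℕ => thermalPairDensity (L + 1) U μ (κ / h) (h / 2)) atTop →
    ε - Real.log 4 / κ ≤ liminf (fun L : ℕ => dWaveSourceDensity (L + 1) U μ h) atTop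

/-- Re-aimed target (C⁺ of card C): sourced GIBBS-state pair order along the ray `β = κ/h`
(temperature `T = h/κ`, source `h/2`) with a floor exceeding the entropy defect `log 4/κ`,
at a density-matched point of the box. Finite-volume objects are unique analytic Gibbs states. -/
def ThermalRayOrder : Prop :=
  ∃ U ∈ Set.Icc (2:ℝ) 3, ∃ δ ∈ Set.Icc (1/5:ℝ) (7/20), ∃ μ : ℝ, DensityClause U δ μ ∧
    ∃ κ ε h₀ : ℝ, 0 < κ ∧ Real.log 4 / κ < ε ∧ 0 < h₀ ∧
      ∀ h ∈ Set.Ioo (0:ℝ) h₀,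
        ε ≤ liminf (fun L : ℕ => thermalPairDensity (L + 1) U μ (κ / h) (h / 2)) atTop

/-- Card C composes into the crux BY NAME. -/
theorem fixedPoint_of_thermalRay (hS : ThermalStairLiminf) (hR : ThermalRayOrder) :
    FixedPointDWaveOrder := by
  obtain ⟨U, hU, δ, hδ, μ, hdens, κ, ε, h₀, hκ, hε, hh₀, hray⟩ := hR
  refine ⟨U, hU, δ, hδ, μ, hdens, ?_⟩
  have hfloor : ε - Real.log 4 / κ ≤ dWaveOrderParameter U μ :=
    le_dWaveOrderParameter_of_forall U μ hh₀ fun h hh => hS U μ κ h ε hκ hh.1 (hray h hh)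
  exact (hasDWaveOrder_iff U μ).2 (lt_of_lt_of_le (by linarith) hfloor)

end Summit.HubbardSuperconductivity.HubbardSuperconductivity.Cruxes.FixedPointDWaveOrder.Ideator2
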